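import Summits.CriticalPhenomena.PercolationContinuityZ3.Theorems.PercNearOneGluingNoHeavyLowerTailSahiGridPatternTwoOrthant
import Summits.CriticalPhenomena.PercolationContinuityZ3.Theorems.PercNearOneGluingNoHeavyLowerTailSahiGridPatternTwoOrthantTopCharts

/-!
# `NoHeavyLowerTail` (crux stmt-CriticalPhenomena-4575), Sahi programme P1: **THE TWO-ORTHANT THEOREM, top-cube case, and the union of
# the two cases: EVERY union of two orthants with disjoint supports is a good slot of the pattern functional in EVERY dimension**

Support file (Sahi cell, seat `prim-sahi-p1`, generation 21; `--supports stmt-CriticalPhenomena-4575`).  Pure proofs, no definitions,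
no `sorry`, standard axioms.  Continues `…SahiGridPatternTwoOrthant` (there: the case of a first orthant `↑a` with a threshold-2 axis).

THE MATHEMATICS.  For `a = 1^n` (`↑a = {1,2}^n`, the top cube) the three fibre forms of the two-orthant identity are chart sums
(seat memo FROM-prim-sahi-p1-gen21-TWO-ORTHANT-THEOREM.md, Theorem 2): a totally distinct pair lies inside `{1,2}^n` iff its third point
is `0`, so `Q_X` is the fibre-Kleitman slack around `0` and `Q_D` the sum of the fibre-Kleitman slacks around every `η ≠ 0`
(`pairKernel_fibreKleitman_weighted_nonneg`, `ind_ones_mul_third`, tree: `sum_fibre_third_le`), and the admissible completions of a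
top-cube point are its charts `T ≠ ∅, univ`, so `Q_E` is a sum of the chart-pair sums of Conjecture B (`pairKernel_topCube_charts_nonneg`,
tree: `chartPair_sum_nonneg`).  With the 33 other lines of the proof unchanged this gives `twoOrthant_hS_of_ones` and
`sStarD_cylSet_twoOrthant_nonneg_of_ones`; together with `…_of_two`:
**`sStarD_cylSet_twoOrthant_nonneg`** — for every `a ∈ {1,2}^n` (`n ≥ 1`), every `b ∈ [3]^k`, every `m` and all up-sets `B, C`:
`0 ≤ sStarD ((↑a × [3]^k ∪ [3]^n × ↑b) × [3]^m) B C`.  Value level: Kahn's `E₃ ≥ 0` for one event an OR of two ANDs on disjoint variable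
sets (read-once monotone DNF of width two), the other two arbitrary increasing.  Nothing here asserts `PatternPos d` for `d ≥ 4`. [this work]
-/

namespace Summit.CriticalPhenomena.PercolationContinuityZ3.Theorems.SahiGridPattern

open Finset SahiGrid3
open scoped BigOperators

variable {n k : ℕ}
/-! ### The theorem for the top cube, and the union of the two cases -/

set_option maxHeartbeats 8000000 in
/-- **THE TWO-ORTHANT THEOREM, (N)-form, top-cube case** (every `n ≥ 1, k`): for `a = 1^n` (so `↑a = {1,2}^n`) and any `b ∈ [3]^k`, with
`X` free-measurable with trace `↑a` and `Y` cell-measurable with trace `↑b`, the hypothesis `hS` of `sStarD_cylSet_pairCert_nonneg_of_sStarD_ge`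
holds: `Φ(A∩A') ≤ sStarD (X∪Y) A A'` for all up-sets `A, A'`. [this work] -/
theorem twoOrthant_hS_of_ones {X Y : Finset (Pd (n + k))} (a : Pd n) (ha : ∀ i, a i = 1) (hn : 0 < n) (b : Pd k)
    (hX : ∀ ξ q, glue ξ q ∈ X ↔ ξ ∈ (univ.filter fun x : Pd n => ∀ i, a i ≤ x i))
    (hY : ∀ ξ q, glue ξ q ∈ Y ↔ q ∈ (univ.filter fun x : Pd k => ∀ j, b j ≤ x j)) :
    ∀ A A' : Finset (Pd (n + k)), IsUpperSet (A : Set (Pd (n + k))) → IsUpperSet (A' : Set (Pd (n + k))) →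
      2 ^ k * (∑ q : Pd k, (1 - ind (univ.filter fun x : Pd k => ∀ j, b j ≤ x j) q) *
          ∑ ξ : Pd n, ind (fibre (A ∩ A') q) ξ * (2 ^ n * ind (univ.filter fun x : Pd n => ∀ i, a i ≤ x i) ξ
            - (nuCount (univ.filter fun x : Pd n => ∀ i, a i ≤ x i) ξ : ℤ)))
        + (∑ ξ : Pd n, (1 - ind (univ.filter fun x : Pd n => ∀ i, a i ≤ x i) ξ)
            * (2 ^ n - (nuCount (univ.filter fun x : Pd n => ∀ i, a i ≤ x i) ξ : ℤ))
            * ∑ q : Pd k, ind (sect (A ∩ A') ξ) q * (2 ^ k * ind (univ.filter fun x : Pd k => ∀ j, b j ≤ x j) q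
              - (nuCount (univ.filter fun x : Pd k => ∀ j, b j ≤ x j) q : ℤ)))
        ≤ sStarD (X ∪ Y) A A' := by
  intro A A' hA hA'
  set XI : Finset (Pd n) := univ.filter fun x : Pd n => ∀ i, a i ≤ x i with hXI
  set YJ : Finset (Pd k) := univ.filter fun x : Pd k => ∀ j, b j ≤ x j with hYJ
  have ha0 : ∃ i, a i ≠ 0 := ⟨⟨0, hn⟩, by rw [ha ⟨0, hn⟩]; decide⟩
  rw [← sub_nonneg, sStarD_union_sub_pairCertSlack_eq_pairSum hX hY A A']
  -- the two local kernels
  set κL : Pd n → Pd n → Pd n → Pd k → Pd k → Pd k → ℤ := (fun (ξ η ζ : Pd n) (q r w : Pd k) => (2 * (ind XI ξ + ind YJ q - ind XI ξ * ind YJ q) * ind A (glue ξ q) * ind A' (glue ξ q) - (ind XI ξ + ind YJ q - ind XI ξ * ind YJ q) * ind A (glue η r) * ind A' (glue η r) - ind A (glue ξ q) * (ind XI η + ind YJ r - ind XI η * ind YJ r) * ind A' (glue η r) - ind A' (glue ξ q) * (ind XI η + ind YJ r - ind XI η * ind YJ r) * ind A (glue η r) + ind A (glue ξ q) * ind A'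 (glue η r) * (ind XI ζ + ind YJ w - ind XI ζ * ind YJ w) - ind A (glue ξ q) * ind A' (glue ξ q) * ((1 - ind YJ q) * (ind XI ξ - ind XI η) + (1 - ind XI ξ) * (1 - ind XI η) * (ind YJ q - ind YJ r)))) with hκL
  set κ1 : Pd n → Pd n → Pd n → Pd k → Pd k → Pd k → ℤ := (fun (ξ η ζ : Pd n) (q r w : Pd k) => (ind XI ξ * (1 - ind XI η)) * (ind A (glue ξ q) * (ind A' (glue η q) * ind YJ q - ind A' (glue η r) * ind YJ r))) with hκ1
  set κ2 : Pd n → Pd n → Pd n → Pd k → Pd k → Pd k → ℤ := (fun (ξ η ζ : Pd n) (q r w : Pd k) => (ind XI ξ * (1 - ind XI η)) * (ind A' (glue ξ q) * (ind A (glue η q) * ind YJ q - ind A (glue η r) * ind YJ r))) with hκ2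
  set κ3 : Pd n → Pd n → Pd n → Pd k → Pd k → Pd k → ℤ := (fun (ξ η ζ : Pd n) (q r w : Pd k) => (ind XI ξ * (1 - ind XI η)) * ((1 - ind YJ q) * ind A (glue ξ r) * (ind A' (glue ξ r) - ind A' (glue ξ w)))) with hκ3
  set κ4 : Pd n → Pd n → Pd n → Pd k → Pd k → Pd k → ℤ := (fun (ξ η ζ : Pd n) (q r w : Pd k) => (ind XI ξ * ind XI η) * (ind A (glue ξ q) * (ind A' (glue ξ q) - ind A' (glue ξ r)))) with hκ4
  set κ5 : Pd n → Pd n → Pd n → Pd k → Pd k → Pd k → ℤ := (fun (ξ η ζ : Pd n) (q r w : Pd k) => ((1 - ind XI ξ) * (1 - ind XI η)) * (ind A (glue ξ q) * ind A' (glue η q) * ind YJ q - ind A (glue ξ q) * ind A' (glue η r) * (ind YJ q + ind YJ r - ind YJ w))) with hκ5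
  set κ6 : Pd n → Pd n → Pd n → Pd k → Pd k → Pd k → ℤ := (fun (ξ η ζ : Pd n) (q r w : Pd k) => ind YJ q * ((1 - ind XI ξ * ind XI η) * (ind A' (glue ξ q) * (ind A (glue ξ q) - ind A (glue η q))))) with hκ6
  set κ7 : Pd n → Pd n → Pd n → Pd k → Pd k → Pd k → ℤ := (fun (ξ η ζ : Pd n) (q r w : Pd k) => (1 - ind YJ w) * ((ind XI ξ * ((1 - ind XI η) * (1 - ind XI ζ))) * ((ind A (glue ξ q) - ind A (glue η q)) * (ind A' (glue ξ r) - ind A' (glue ζ r))))) with hκ7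
  set κ8 : Pd n → Pd n → Pd n → Pd k → Pd k → Pd k → ℤ := (fun (ξ η ζ : Pd n) (q r w : Pd k) => (2 - ind YJ w) * ((ind XI ξ * ind XI η) * ((ind A (glue ξ q) - ind A (glue η q)) * ind A' (glue ξ r)))) with hκ8
  set κR : Pd n → Pd n → Pd n → Pd k → Pd k → Pd k → ℤ :=
    (fun (ξ η ζ : Pd n) (q r w : Pd k) => κ1 ξ η ζ q r w + κ2 ξ η ζ q r w + κ3 ξ η ζ q r w + κ4 ξ η ζ q r w
      + κ5 ξ η ζ q r w + κ6 ξ η ζ q r w + κ7 ξ η ζ q r w + κ8 ξ η ζ q r w) with hκR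
  -- the goal is `0 ≤ PS κL`
  show 0 ≤ (∑ ξ : Pd n, ∑ η : Pd n, ∑ q : Pd k, ∑ r : Pd k, (if TotDist ξ η = true then (1:ℤ) else 0) * (if TotDist q r = true then (1:ℤ) else 0) * (κL ξ η (thirdPt ξ η) q r (thirdPt q r)))
  -- symmetrisation: 36·PS(κ) = PS(sym36 κ)
  have hL6 := ps_symJ6 κL
  have hL36 := ps_symI6 (fun (ξ η ζ : Pd n) (q r w : Pd k) => κL ξ η ζ q r w + κL ξ η ζ r q w + κL ξ η ζ q w r + κL ξ η ζ r w q + κL ξ η ζ w q r + κL ξ η ζ w r q)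
  try dsimp only at hL36
  have hR6 := ps_symJ6 κR
  have hR36 := ps_symI6 (fun (ξ η ζ : Pd n) (q r w : Pd k) => κR ξ η ζ q r w + κR ξ η ζ r q w + κR ξ η ζ q w r + κR ξ η ζ r w q + κR ξ η ζ w q r + κR ξ η ζ w r q)
  try dsimp only at hR36
  -- the pointwise identity of the symmetrised kernels
  have hpt : (∑ ξ : Pd n, ∑ η : Pd n, ∑ q : Pd k, ∑ r : Pd k, (if TotDist ξ η = true then (1:ℤ) else 0) * (if TotDist q r = true then (1:ℤ) else 0) * ((κL ξ η (thirdPt ξ η) q r (thirdPt q r)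
            + κL ξ η (thirdPt ξ η) r q (thirdPt q r)
            + κL ξ η (thirdPt ξ η) q (thirdPt q r) r
            + κL ξ η (thirdPt ξ η) r (thirdPt q r) q
            + κL ξ η (thirdPt ξ η) (thirdPt q r) q r
            + κL ξ η (thirdPt ξ η) (thirdPt q r) r q)
          + (κL η ξ (thirdPt ξ η) q r (thirdPt q r)
            + κL η ξ (thirdPt ξ η) r q (thirdPt q r)
            + κL η ξ (thirdPt ξ η) q (thirdPt q r) r
            + κL η ξ (thirdPt ξ η) r (thirdPt q r) q
            + κL η ξ (thirdPt ξ η) (thirdPt q r) q r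
            + κL η ξ (thirdPt ξ η) (thirdPt q r) r q)
          + (κL ξ (thirdPt ξ η) η q r (thirdPt q r)
            + κL ξ (thirdPt ξ η) η r q (thirdPt q r)
            + κL ξ (thirdPt ξ η) η q (thirdPt q r) r
            + κL ξ (thirdPt ξ η) η r (thirdPt q r) q
            + κL ξ (thirdPt ξ η) η (thirdPt q r) q r
            + κL ξ (thirdPt ξ η) η (thirdPt q r) r q)
          + (κL η (thirdPt ξ η) ξ q r (thirdPt q r)
            + κL η (thirdPt ξ η) ξ r q (thirdPt q r)
            + κL η (thirdPt ξ η) ξ q (thirdPt q r) r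
            + κL η (thirdPt ξ η) ξ r (thirdPt q r) q
            + κL η (thirdPt ξ η) ξ (thirdPt q r) q r
            + κL η (thirdPt ξ η) ξ (thirdPt q r) r q)
          + (κL (thirdPt ξ η) ξ η q r (thirdPt q r)
            + κL (thirdPt ξ η) ξ η r q (thirdPt q r)
            + κL (thirdPt ξ η) ξ η q (thirdPt q r) r
            + κL (thirdPt ξ η) ξ η r (thirdPt q r) q
            + κL (thirdPt ξ η) ξ η (thirdPt q r) q r
            + κL (thirdPt ξ η) ξ η (thirdPt q r) r q)
          + (κL (thirdPt ξ η) η ξ q r (thirdPt q r)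
            + κL (thirdPt ξ η) η ξ r q (thirdPt q r)
            + κL (thirdPt ξ η) η ξ q (thirdPt q r) r
            + κL (thirdPt ξ η) η ξ r (thirdPt q r) q
            + κL (thirdPt ξ η) η ξ (thirdPt q r) q r
            + κL (thirdPt ξ η) η ξ (thirdPt q r) r q)))
      = (∑ ξ : Pd n, ∑ η : Pd n, ∑ q : Pd k, ∑ r : Pd k, (if TotDist ξ η = true then (1:ℤ) else 0) * (if TotDist q r = true then (1:ℤ) else 0) * ((κR ξ η (thirdPt ξ η) q r (thirdPt q r)
            + κR ξ η (thirdPt ξ η) r q (thirdPt q r)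
            + κR ξ η (thirdPt ξ η) q (thirdPt q r) r
            + κR ξ η (thirdPt ξ η) r (thirdPt q r) q
            + κR ξ η (thirdPt ξ η) (thirdPt q r) q r
            + κR ξ η (thirdPt ξ η) (thirdPt q r) r q)
          + (κR η ξ (thirdPt ξ η) q r (thirdPt q r)
            + κR η ξ (thirdPt ξ η) r q (thirdPt q r)
            + κR η ξ (thirdPt ξ η) q (thirdPt q r) r
            + κR η ξ (thirdPt ξ η) r (thirdPt q r) q
            + κR η ξ (thirdPt ξ η) (thirdPt q r) q r
            + κR η ξ (thirdPt ξ η) (thirdPt q r) r q)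
          + (κR ξ (thirdPt ξ η) η q r (thirdPt q r)
            + κR ξ (thirdPt ξ η) η r q (thirdPt q r)
            + κR ξ (thirdPt ξ η) η q (thirdPt q r) r
            + κR ξ (thirdPt ξ η) η r (thirdPt q r) q
            + κR ξ (thirdPt ξ η) η (thirdPt q r) q r
            + κR ξ (thirdPt ξ η) η (thirdPt q r) r q)
          + (κR η (thirdPt ξ η) ξ q r (thirdPt q r)
            + κR η (thirdPt ξ η) ξ r q (thirdPt q r)
            + κR η (thirdPt ξ η) ξ q (thirdPt q r) r
            + κR η (thirdPt ξ η) ξ r (thirdPt q r) q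
            + κR η (thirdPt ξ η) ξ (thirdPt q r) q r
            + κR η (thirdPt ξ η) ξ (thirdPt q r) r q)
          + (κR (thirdPt ξ η) ξ η q r (thirdPt q r)
            + κR (thirdPt ξ η) ξ η r q (thirdPt q r)
            + κR (thirdPt ξ η) ξ η q (thirdPt q r) r
            + κR (thirdPt ξ η) ξ η r (thirdPt q r) q
            + κR (thirdPt ξ η) ξ η (thirdPt q r) q r
            + κR (thirdPt ξ η) ξ η (thirdPt q r) r q)
          + (κR (thirdPt ξ η) η ξ q r (thirdPt q r)
            + κR (thirdPt ξ η) η ξ r q (thirdPt q r)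
            + κR (thirdPt ξ η) η ξ q (thirdPt q r) r
            + κR (thirdPt ξ η) η ξ r (thirdPt q r) q
            + κR (thirdPt ξ η) η ξ (thirdPt q r) q r
            + κR (thirdPt ξ η) η ξ (thirdPt q r) r q))) := by
    refine Finset.sum_congr rfl fun ξ _ => Finset.sum_congr rfl fun η _ => Finset.sum_congr rfl fun q _ => Finset.sum_congr rfl fun r _ => ?_
    by_cases hτ : TotDist ξ η = true
    · have hz := ind_orthant_latin_zero a ha0 hτ
      rw [← hXI] at hz
      simp only [hκL, hκR, hκ1, hκ2, hκ3, hκ4, hκ5, hκ6, hκ7, hκ8]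
      rcases hz with h | h | h <;> simp only [h] <;> ring
    · rw [if_neg hτ]; ring
  have key : 36 * (∑ ξ : Pd n, ∑ η : Pd n, ∑ q : Pd k, ∑ r : Pd k, (if TotDist ξ η = true then (1:ℤ) else 0) * (if TotDist q r = true then (1:ℤ) else 0) * (κL ξ η (thirdPt ξ η) q r (thirdPt q r)))
      = 36 * (∑ ξ : Pd n, ∑ η : Pd n, ∑ q : Pd k, ∑ r : Pd k, (if TotDist ξ η = true then (1:ℤ) else 0) * (if TotDist q r = true then (1:ℤ) else 0) * (κR ξ η (thirdPt ξ η) q r (thirdPt q r))) := by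
    have e1 : (36:ℤ) * (∑ ξ : Pd n, ∑ η : Pd n, ∑ q : Pd k, ∑ r : Pd k, (if TotDist ξ η = true then (1:ℤ) else 0) * (if TotDist q r = true then (1:ℤ) else 0) * (κL ξ η (thirdPt ξ η) q r (thirdPt q r))) = 6 * (6 * (∑ ξ : Pd n, ∑ η : Pd n, ∑ q : Pd k, ∑ r : Pd k, (if TotDist ξ η = true then (1:ℤ) else 0) * (if TotDist q r = true then (1:ℤ) else 0) * (κL ξ η (thirdPt ξ η) q r (thirdPt q r)))) := by ring
    have e2 : (36:ℤ) * (∑ ξ : Pd n, ∑ η : Pd n, ∑ q : Pd k, ∑ r : Pd k, (if TotDist ξ η = true then (1:ℤ) else 0) * (if TotDist q r = true then (1:ℤ) else 0) * (κR ξ η (thirdPt ξ η) q r (thirdPt q r))) = 6 * (6 * (∑ ξ : Pd n, ∑ η : Pd n, ∑ q : Pd k, ∑ r : Pd k, (if TotDist ξ η = true then (1:ℤ) else 0) * (if TotDist q r = true then (1:ℤ) else 0) * (κR ξ η (thirdPt ξ η) q r (thirdPt q r)))) := by ring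
    rw [e1, e2, ← hL6, ← hR6, ← hL36, ← hR36]
    exact hpt
  have hRnonneg : 0 ≤ (∑ ξ : Pd n, ∑ η : Pd n, ∑ q : Pd k, ∑ r : Pd k, (if TotDist ξ η = true then (1:ℤ) else 0) * (if TotDist q r = true then (1:ℤ) else 0) * (κR ξ η (thirdPt ξ η) q r (thirdPt q r))) := by
    simp only [hκR, mul_add, Finset.sum_add_distrib]
    have hsecA : ∀ ξ : Pd n, IsUpperSet ((sect A ξ : Finset (Pd k)) : Set (Pd k)) := fun ξ => isUpperSet_sect hA ξ
    have hsecA' : ∀ ξ : Pd n, IsUpperSet ((sect A' ξ : Finset (Pd k)) : Set (Pd k)) := fun ξ => isUpperSet_sect hA' ξ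
    have hfibA : ∀ q : Pd k, IsUpperSet ((fibre A q : Finset (Pd n)) : Set (Pd n)) := fun q => isUpperSet_fibre hA q
    have hfibA' : ∀ q : Pd k, IsUpperSet ((fibre A' q : Finset (Pd n)) : Set (Pd n)) := fun q => isUpperSet_fibre hA' q
    have hYJup : IsUpperSet (YJ : Set (Pd k)) := by rw [hYJ]; exact isUpperSet_filter_le b
    have i01 : ∀ (S : Finset (Pd n)) (x : Pd n), 0 ≤ ind S x ∧ ind S x ≤ 1 := fun S x => ⟨ind_nonneg' S x, ind_le_one' S x⟩
    have j01 : ∀ (S : Finset (Pd k)) (x : Pd k), 0 ≤ ind S x ∧ ind S x ≤ 1 := fun S x => ⟨ind_nonneg' S x, ind_le_one' S x⟩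
    -- family 1: Harris(A_ξ, A'_η ∩ Y)
    have f1 : 0 ≤ (∑ ξ : Pd n, ∑ η : Pd n, ∑ q : Pd k, ∑ r : Pd k, (if TotDist ξ η = true then (1:ℤ) else 0) * (if TotDist q r = true then (1:ℤ) else 0) * (κ1 ξ η (thirdPt ξ η) q r (thirdPt q r))) := by
      simp only [hκ1]
      refine ps_nonneg_of_innerJ (fun ξ η => ind XI ξ * (1 - ind XI η))
        (fun ξ η q r w => ind A (glue ξ q) * (ind A' (glue η q) * ind YJ q - ind A' (glue η r) * ind YJ r)) ?_ ?_
      · intro ξ η; nlinarith [i01 XI ξ, i01 XI η]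
      · intro ξ η _
        have h := pairKernel_harris_nonneg (sect A ξ) (sect A' η ∩ YJ) (hsecA ξ) (isUpperSet_inter_coe (hsecA' η) hYJup)
        simp only [ind_inter_eq_mul, ind_sect] at h
        exact h
    -- family 2: Harris(A'_ξ, A_η ∩ Y)
    have f2 : 0 ≤ (∑ ξ : Pd n, ∑ η : Pd n, ∑ q : Pd k, ∑ r : Pd k, (if TotDist ξ η = true then (1:ℤ) else 0) * (if TotDist q r = true then (1:ℤ) else 0) * (κ2 ξ η (thirdPt ξ η) q r (thirdPt q r))) := by
      simp only [hκ2]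
      refine ps_nonneg_of_innerJ (fun ξ η => ind XI ξ * (1 - ind XI η))
        (fun ξ η q r w => ind A' (glue ξ q) * (ind A (glue η q) * ind YJ q - ind A (glue η r) * ind YJ r)) ?_ ?_
      · intro ξ η; nlinarith [i01 XI ξ, i01 XI η]
      · intro ξ η _
        have h := pairKernel_harris_nonneg (sect A' ξ) (sect A η ∩ YJ) (hsecA' ξ) (isUpperSet_inter_coe (hsecA η) hYJup)
        simp only [ind_inter_eq_mul, ind_sect] at h
        exact h
    -- family 3: Kleitman(Ȳ; A_ξ, A'_ξ)
    have f3 : 0 ≤ (∑ ξ : Pd n, ∑ η : Pd n, ∑ q : Pd k, ∑ r : Pd k, (if TotDist ξ η = true then (1:ℤ) else 0) * (if TotDist q r = true then (1:ℤ) else 0) * (κ3 ξ η (thirdPt ξ η) q r (thirdPt q r))) := by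
      simp only [hκ3]
      refine ps_nonneg_of_innerJ (fun ξ η => ind XI ξ * (1 - ind XI η))
        (fun ξ η q r w => (1 - ind YJ q) * ind A (glue ξ r) * (ind A' (glue ξ r) - ind A' (glue ξ w))) ?_ ?_
      · intro ξ η; nlinarith [i01 XI ξ, i01 XI η]
      · intro ξ η _
        have h := pairKernel_kleitman_nonneg (univ \ YJ) (sect A ξ) (sect A' ξ) (hsecA ξ) (hsecA' ξ)
        simp only [ind_sdiff_univ, ind_sect] at h
        exact h
    -- family 4: Harris(A_ξ, A'_ξ)
    have f4 : 0 ≤ (∑ ξ : Pd n, ∑ η : Pd n, ∑ q : Pd k, ∑ r : Pd k, (if TotDist ξ η = true then (1:ℤ) else 0) * (if TotDist q r = true then (1:ℤ) else 0) * (κ4 ξ η (thirdPt ξ η) q r (thirdPt q r))) := by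
      simp only [hκ4]
      refine ps_nonneg_of_innerJ (fun ξ η => ind XI ξ * ind XI η)
        (fun ξ η q r w => ind A (glue ξ q) * (ind A' (glue ξ q) - ind A' (glue ξ r))) ?_ ?_
      · intro ξ η; nlinarith [i01 XI ξ, i01 XI η]
      · intro ξ η _
        have h := pairKernel_harris_nonneg (sect A ξ) (sect A' ξ) (hsecA ξ) (hsecA' ξ)
        simp only [ind_sect] at h
        exact h
    -- family 5: Conjecture P for the orthant `YJ` (Θ-form)
    have f5 : 0 ≤ (∑ ξ : Pd n, ∑ η : Pd n, ∑ q : Pd k, ∑ r : Pd k, (if TotDist ξ η = true then (1:ℤ) else 0) * (if TotDist q r = true then (1:ℤ) else 0) * (κ5 ξ η (thirdPt ξ η) q r (thirdPt q r))) := by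
      simp only [hκ5]
      refine ps_nonneg_of_innerJ (fun ξ η => (1 - ind XI ξ) * (1 - ind XI η))
        (fun ξ η q r w => ind A (glue ξ q) * ind A' (glue η q) * ind YJ q
          - ind A (glue ξ q) * ind A' (glue η r) * (ind YJ q + ind YJ r - ind YJ w)) ?_ ?_
      · intro ξ η; nlinarith [i01 XI ξ, i01 XI η]
      · intro ξ η _
        have h := pairKernel_conjP_theta_nonneg b (sect A ξ) (sect A' η) (hsecA ξ) (hsecA' η)
        rw [← hYJ] at h
        simp only [ind_sect] at h
        exact h
    -- family 6: fibre Kleitman around every middle point `η ≠ 0` (chart form of `Q_D` for the top cube)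
    have f6 : 0 ≤ (∑ ξ : Pd n, ∑ η : Pd n, ∑ q : Pd k, ∑ r : Pd k, (if TotDist ξ η = true then (1:ℤ) else 0) * (if TotDist q r = true then (1:ℤ) else 0) * (κ6 ξ η (thirdPt ξ η) q r (thirdPt q r))) := by
      simp only [hκ6]
      refine ps_nonneg_of_innerI (fun q r w => ind YJ q)
        (fun ξ η ζ q r => (1 - ind XI ξ * ind XI η) * (ind A' (glue ξ q) * (ind A (glue ξ q) - ind A (glue η q)))) ?_ ?_
      · intro q r; exact (j01 YJ q).1
      · intro q r _
        have h := pairKernel_fibreKleitman_weighted_nonneg (fun η : Pd n => 1 - (if η = 0 then (1:ℤ) else 0))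
          (fun η => by split_ifs <;> norm_num) (fibre A q) (fibre A' q) (hfibA q) (hfibA' q)
        simp only [ind_fibre] at h
        rw [pairSum_rot (fun ξ η ζ => (1 - ind XI ξ * ind XI η) * (ind A' (glue ξ q) * (ind A (glue ξ q) - ind A (glue η q))))]
        have e : (∑ ξ : Pd n, ∑ η : Pd n, (if TotDist ξ η = true then (1:ℤ) else 0) *
            ((1 - ind XI ξ * ind XI (thirdPt ξ η)) * (ind A' (glue ξ q) * (ind A (glue ξ q) - ind A (glue (thirdPt ξ η) q)))))
            = ∑ ξ : Pd n, ∑ η : Pd n, (if TotDist ξ η = true then (1:ℤ) else 0) *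
              ((1 - (if η = 0 then (1:ℤ) else 0)) * (ind A' (glue ξ q) * (ind A (glue ξ q) - ind A (glue (thirdPt ξ η) q)))) := by
          refine Finset.sum_congr rfl fun ξ _ => Finset.sum_congr rfl fun η _ => ?_
          by_cases hτ : TotDist ξ η = true
          · have hz := ind_ones_mul_third a ha hτ
            rw [← hXI] at hz
            rw [hz]
          · rw [if_neg hτ]; ring
        rw [e]; exact h
    -- family 7: the chart pairs of Conjecture B for the top cube (chart form of `Q_E`)
    have f7 : 0 ≤ (∑ ξ : Pd n, ∑ η : Pd n, ∑ q : Pd k, ∑ r : Pd k, (if TotDist ξ η = true then (1:ℤ) else 0) * (if TotDist q r = true then (1:ℤ) else 0) * (κ7 ξ η (thirdPt ξ η) q r (thirdPt q r))) := by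
      simp only [hκ7]
      refine ps_nonneg_of_innerI (fun q r w => 1 - ind YJ w)
        (fun ξ η ζ q r => (ind XI ξ * ((1 - ind XI η) * (1 - ind XI ζ))) * ((ind A (glue ξ q) - ind A (glue η q)) * (ind A' (glue ξ r) - ind A' (glue ζ r)))) ?_ ?_
      · intro q r; nlinarith [j01 YJ (thirdPt q r)]
      · intro q r _
        have h := pairKernel_topCube_charts_nonneg a ha (fibre A q) (fibre A' r) (hfibA q) (hfibA' r)
        rw [← hXI] at h
        simp only [ind_fibre] at h
        exact h
    -- family 8: fibre Kleitman around `0` (chart form of `Q_X` for the top cube)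
    have f8 : 0 ≤ (∑ ξ : Pd n, ∑ η : Pd n, ∑ q : Pd k, ∑ r : Pd k, (if TotDist ξ η = true then (1:ℤ) else 0) * (if TotDist q r = true then (1:ℤ) else 0) * (κ8 ξ η (thirdPt ξ η) q r (thirdPt q r))) := by
      simp only [hκ8]
      refine ps_nonneg_of_innerI (fun q r w => 2 - ind YJ w)
        (fun ξ η ζ q r => (ind XI ξ * ind XI η) * ((ind A (glue ξ q) - ind A (glue η q)) * ind A' (glue ξ r))) ?_ ?_
      · intro q r; nlinarith [j01 YJ (thirdPt q r)]
      · intro q r _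
        have h := pairKernel_fibreKleitman_weighted_nonneg (fun η : Pd n => if η = 0 then (1:ℤ) else 0)
          (fun η => by split_ifs <;> norm_num) (fibre A q) (fibre A' r) (hfibA q) (hfibA' r)
        simp only [ind_fibre] at h
        rw [pairSum_rot (fun ξ η ζ => (ind XI ξ * ind XI η) * ((ind A (glue ξ q) - ind A (glue η q)) * ind A' (glue ξ r)))]
        have e : (∑ ξ : Pd n, ∑ η : Pd n, (if TotDist ξ η = true then (1:ℤ) else 0) *
            ((ind XI ξ * ind XI (thirdPt ξ η)) * ((ind A (glue ξ q) - ind A (glue (thirdPt ξ η) q)) * ind A' (glue ξ r))))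
            = ∑ ξ : Pd n, ∑ η : Pd n, (if TotDist ξ η = true then (1:ℤ) else 0) *
              ((if η = 0 then (1:ℤ) else 0) * (ind A' (glue ξ r) * (ind A (glue ξ q) - ind A (glue (thirdPt ξ η) q)))) := by
          refine Finset.sum_congr rfl fun ξ _ => Finset.sum_congr rfl fun η _ => ?_
          by_cases hτ : TotDist ξ η = true
          · have hz := ind_ones_mul_third a ha hτ
            rw [← hXI] at hz
            rw [hz]; ring
          · rw [if_neg hτ]; ring
        rw [e]; exact h
    linarith [f1, f2, f3, f4, f5, f6, f7, f8]
  linarith [key, hRnonneg]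


/-- **THE TWO-ORTHANT THEOREM, top-cube case** (every dimension): for `a = 1^n` (`n ≥ 1`) and any `b ∈ [3]^k`, the union
`↑a × [3]^k ∪ [3]^n × ↑b` is a good slot of the pattern functional in every dimension. [this work] -/
theorem sStarD_cylSet_twoOrthant_nonneg_of_ones {m : ℕ} (a : Pd n) (ha : ∀ i, a i = 1) (hn : 0 < n) (b : Pd k)
    {B C : Finset (Pd (m + (n + k)))} (hB : IsUpperSet (B : Set (Pd (m + (n + k))))) (hC : IsUpperSet (C : Set (Pd (m + (n + k))))) :
    0 ≤ sStarD (cylSet ((univ.filter fun x : Pd (n + k) => ∀ i, a i ≤ x (Fin.castAdd k i))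
        ∪ (univ.filter fun x : Pd (n + k) => ∀ j, b j ≤ x (Fin.natAdd n j))) : Finset (Pd (m + (n + k)))) B C := by
  have hX : ∀ (ξ : Pd n) (q : Pd k), glue ξ q ∈ (univ.filter fun x : Pd (n + k) => ∀ i, a i ≤ x (Fin.castAdd k i))
      ↔ ξ ∈ (univ.filter fun x : Pd n => ∀ i, a i ≤ x i) := by
    intro ξ q; simp only [Finset.mem_filter, Finset.mem_univ, true_and, glue_castAdd]
  have hY : ∀ (ξ : Pd n) (q : Pd k), glue ξ q ∈ (univ.filter fun x : Pd (n + k) => ∀ j, b j ≤ x (Fin.natAdd n j))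
      ↔ q ∈ (univ.filter fun x : Pd k => ∀ j, b j ≤ x j) := by
    intro ξ q; simp only [Finset.mem_filter, Finset.mem_univ, true_and, glue_natAdd]
  exact sStarD_cylSet_pairCert_nonneg_of_sStarD_ge hX hY (isUpperSet_filter_le a) (isUpperSet_filter_le b)
    (twoOrthant_hS_of_ones a ha hn b hX hY) hB hC

/-- **EVERY UNION OF TWO ORTHANTS WITH DISJOINT SUPPORTS IS A GOOD SLOT IN EVERY DIMENSION**: for `a ∈ {1,2}^n` (`n ≥ 1`, no zero
threshold) and any `b ∈ [3]^k`, and all `m`, all up-sets `B, C ⊆ [3]^{m+(n+k)}`: `0 ≤ sStarD ((↑a × [3]^k ∪ [3]^n × ↑b) × [3]^m) B C`.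
(Zero thresholds of `a` are free axes; a union whose first orthant has them is, up to the order of the axes, a cylinder over one without.)
VALUE LEVEL (`latticeE3_symm`, pull-backs): Kahn's `E₃(1_A,1_B,1_C) ≥ 0` under every product measure whenever `A` is an OR of two ANDs on
disjoint sets of variables and `B, C` are arbitrary increasing events — for all threshold patterns whose first block has no free axis. [this work] -/
theorem sStarD_cylSet_twoOrthant_nonneg {m : ℕ} (a : Pd n) (ha : ∀ i, a i ≠ 0) (hn : 0 < n) (b : Pd k)
    {B C : Finset (Pd (m + (n + k)))} (hB : IsUpperSet (B : Set (Pd (m + (n + k))))) (hC : IsUpperSet (C : Set (Pd (m + (n + k))))) :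
    0 ≤ sStarD (cylSet ((univ.filter fun x : Pd (n + k) => ∀ i, a i ≤ x (Fin.castAdd k i))
        ∪ (univ.filter fun x : Pd (n + k) => ∀ j, b j ≤ x (Fin.natAdd n j))) : Finset (Pd (m + (n + k)))) B C := by
  by_cases h2 : ∃ i, a i = 2
  · exact sStarD_cylSet_twoOrthant_nonneg_of_two a h2 b hB hC
  · have h1 : ∀ i, a i = 1 := by
      intro i
      have key : ∀ v : Fin 3, v ≠ 0 → v ≠ 2 → v = 1 := by decide
      exact key (a i) (ha i) (fun h => h2 ⟨i, h⟩)
    exact sStarD_cylSet_twoOrthant_nonneg_of_ones a h1 hn b hB hC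

end Summit.CriticalPhenomena.PercolationContinuityZ3.Theorems.SahiGridPattern
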